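import Mathlib
import HarnessLib
import HarnessLib.Audit
import Summits.AtomisticToContinuum.Statement
import Literature.MathematicalPhysics.StatisticalMechanics.BarlowStacking
import Summits.AtomisticToContinuum.Crystallization.Theorems.ExcessDecayLiouvilleCrysEnergyLimit
import HarnessLib.Audit.Status.Attr

/-!
Route: SymmetryRankLadder

# Route SymmetryRankLadder — impose two periods, free the third — transverse compactness +
triangular layering + monolayer-stack locking give the periodic LJ minimum (relaxed hcp)

It suffices to show X := R2per ∧ (ii), realising card symmetry-rank-ladder-imposed-periods
(ideator-22; rung 2 of the
SYMMETRY-RANK LADDER, in the periodic shadow that conjunct (i) needs). Rung 2 says: minimising the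
Lennard-Jones energy per
particle over configurations of ℝ³ on which TWO independent short periods are imposed — a problem on
(ℝ²/Λ) × ℝ, one-dimensional
in the free direction — is attained by a fully periodic configuration. For periodic competitors this
splits into three typed
statements of three different dimensions: (C2) TransverseCompactness — every periodic configuration
is matched, at no higher
energy per particle, by one with hard core 1/2 whose period lattice contains two linearly
independent vectors of length ≤ 6/5
("two bounded periods suffice": the only genuinely 3-D input); (L2) TriangularLayering — at such
bounded transverse data the
competitor is matched by a stack of rigid triangular monolayers A₂(a), a ∈ [0.94, 1], with free
lateral offsets and free
spacings in [0.7, 1] (a 2-D lattice problem coupled along a chain); (S2′) MonolayerStackOptimality —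
every such stack is beaten
by a relaxed hcp with (a, h) in the box B = [0.94,1] × [0.78a, 0.85a] (1-D locking: hole registry +
Bessel-signed couplings +
Hägg/Peierls count). With HcpEnergyMinOnBox (3066) they give the target HcpPeriodicMinimiser (3061,
shared with
PoissonBesselStacking — this route is an alternative, rank-by-rank decomposition of the same
target), hence attainment of the
periodic infimum (0627) and, with the bookkeeping limit CrysEnergyLimit (0626), conjunct (i).
Conjunct (ii) = CrysPositional
(0625) is imported, not claimed: it is rung 0 of the ladder.
Lean: `(∀ Q : Literature.MathematicalPhysics.StatisticalMechanics.PeriodicConfiguration 3, ∃ Q' :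
Literature.MathematicalPhysics.StatisticalMechanics.PeriodicConfiguration 3, Q'.energyPerParticle
Literature.MathematicalPhysics.StatisticalMechanics.lennardJones ≤ Q.energyPerParticle
Literature.MathematicalPhysics.StatisticalMechanics.lennardJones ∧ (∀ x ∈ Q'.points, ∀ y ∈
Q'.points, x ≠ y → (1 / 2 : ℝ) ≤ dist x y) ∧ (∃ u ∈ Q'.lattice, ∃ v ∈ Q'.lattice, LinearIndependent
ℝ ![u, v] ∧ ‖u‖ ≤ 6 / 5 ∧ ‖v‖ ≤ 6 / 5)) ∧ (∀ Q :
Literature.MathematicalPhysics.StatisticalMechanics.PeriodicConfiguration 3, (∀ x ∈ Q.points, ∀ y ∈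
Q.points, x ≠ y → (1 / 2 : ℝ) ≤ dist x y) → (∃ u ∈ Q.lattice, ∃ v ∈ Q.lattice, LinearIndependent ℝ
![u, v] ∧ ‖u‖ ≤ 6 / 5 ∧ ‖v‖ ≤ 6 / 5) → ∃ Q' :
Literature.MathematicalPhysics.StatisticalMechanics.PeriodicConfiguration 3, Q'.energyPerParticle
Literature.MathematicalPhysics.StatisticalMechanics.lennardJones ≤ Q.energyPerParticle
Literature.MathematicalPhysics.StatisticalMechanics.lennardJones ∧ ∃ a : ℝ, 47 / 50 ≤ a ∧ a ≤ 1 ∧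
Literature.MathematicalPhysics.StatisticalMechanics.triangularVec₁ a ∈ Q'.lattice ∧
Literature.MathematicalPhysics.StatisticalMechanics.triangularVec₂ a ∈ Q'.lattice ∧ (∀ x ∈
Q'.points, ∀ y ∈ Q'.points, x 2 = y 2 → x - y ∈ Submodule.span ℤ
({Literature.MathematicalPhysics.StatisticalMechanics.triangularVec₁ a,
Literature.MathematicalPhysics.StatisticalMechanics.triangularVec₂ a} : Set (EuclideanSpace ℝ (Fin
3)))) ∧ (∀ x ∈ Q'.points, ∀ y ∈ Q'.points, x 2 ≠ y 2 → (7 / 10 : ℝ) ≤ |x 2 - y 2|) ∧ (∀ x ∈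
Q'.points, ∃ y ∈ Q'.points, (7 / 10 : ℝ) ≤ y 2 - x 2 ∧ y 2 - x 2 ≤ 1)) ∧ (∀ Q :
Literature.MathematicalPhysics.StatisticalMechanics.PeriodicConfiguration 3, ∀ a : ℝ, 47 / 50 ≤ a →
a ≤ 1 → Literature.MathematicalPhysics.StatisticalMechanics.triangularVec₁ a ∈ Q.lattice ∧
Literature.MathematicalPhysics.StatisticalMechanics.triangularVec₂ a ∈ Q.lattice ∧ (∀ x ∈ Q.points,
∀ y ∈ Q.points, x 2 = y 2 → x - y ∈ Submodule.span ℤ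
({Literature.MathematicalPhysics.StatisticalMechanics.triangularVec₁ a,
Literature.MathematicalPhysics.StatisticalMechanics.triangularVec₂ a} : Set (EuclideanSpace ℝ (Fin
3)))) ∧ (∀ x ∈ Q.points, ∀ y ∈ Q.points, x 2 ≠ y 2 → (7 / 10 : ℝ) ≤ |x 2 - y 2|) ∧ (∀ x ∈ Q.points,
∃ y ∈ Q.points, (7 / 10 : ℝ) ≤ y 2 - x 2 ∧ y 2 - x 2 ≤ 1) → ∃ a' h : ℝ, ∃ (ha : a' ≠ 0) (hh : h ≠
0), 47 / 50 ≤ a' ∧ a' ≤ 1 ∧ 39 / 50 * a' ≤ h ∧ h ≤ 17 / 20 * a' ∧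
(Literature.MathematicalPhysics.StatisticalMechanics.hcpPeriodicConfiguration ha
hh).energyPerParticle Literature.MathematicalPhysics.StatisticalMechanics.lennardJones ≤
Q.energyPerParticle Literature.MathematicalPhysics.StatisticalMechanics.lennardJones) ∧
Literature.MathematicalPhysics.StatisticalMechanics.IsCrystallizing
Literature.MathematicalPhysics.StatisticalMechanics.lennardJones 3`

## Assembly
Pure logic plus one PROVED Literature theorem, checked in the planner's Sketch.lean
(`assembly_provable`, `rungTwoGlue_provable`,
lean check rc 0, no sorry): RungTwoGlue turns the three rung-2 cruxes and HcpEnergyMinOnBox into the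
target HcpPeriodicMinimiser;
the target gives ∃ P, IsLeast (range e) (e P); with CrysEnergyLimit (E(N)/N → ⨅) and the imported
conjunct CrysPositional,
`Literature.StatMech.crystallization_of_isLeast_tendsto_isCrystallizing`
(Theorems/CrystalLocalRigidityAssembly, item 0622, proved)
rewrites ⨅ = e(P) (IsLeast.csInf_eq) and returns the sub-problem constant `Crystallization`
(root-level abbrev of the Literature statement).

Rationale: WHY THIS LINE. The card's mechanism is a filtration nobody has used on this problem: by the RANK OF
IMPOSED TRANSLATION SYMMETRY, 𝒞₃ ⊂ 𝒞₂ ⊂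
𝒞₁ ⊂ 𝒞₀ (periodic ⊂ two imposed periods ⊂ one ⊂ none), with equal infima (periodisation with
vanishing seam cost, BlancLewin2015
§1.3 (8); in-tree CrysPeriodisationLe 0715) and with every restricted minimiser an equilibrium of
the free problem (Palais1979,
symmetric criticality for the isometric Λ-action, finite-dimensional per cell); rung 2 already
implies conjunct (i), and
converts "attainment of the periodic infimum" into a transverse compactness statement plus a 2-D
lattice problem plus a 1-D
chain. The 2-D step lives where universal optimality IS a theorem among lattices (Montgomery1988: A₂
minimises every lattice
theta function; Betermin2023 arXiv:2104.09795: computer-assisted LJ-type lattice optimality) and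
where BeterminPetrache2017
(arXiv:1607.08716, Thm 1.1, Prop 1.2) already proved a rank-(d−1)-imposed statement — layers of a
FIXED lattice Λ₀, hole-valued
stacking letters, completely monotone potentials (FCC < HCP); the 1-D step is long-range lattice-gas
locking (RadinSchulman1983)
with the LJ registry couplings typed and Bessel-signed by the sibling route PoissonBesselStacking
(3063/3064/0737). Imported
areas: equivariant variational calculus (the ladder, symmetric criticality), 2-D
lattice/theta-function theory, 1-D
ground-state locking; FriedrichKreutz2023 (arXiv:2209.14880, stratification) is the one printed
slicing proof of
crystallization and is finite, planar and imposes nothing. What the line does that prior routes do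
not: CrystalLocalRigidity /
CrystalKissingRigidity / CrystalThreeCone reach (i) through finite-N local inequalities,
PoissonBesselStacking through one blunt
crux PeriodicReductionToBarlow (∀ periodic Q ∃ better uniform Barlow stacking); this route splits
that blunt statement along the
symmetry rank into three strictly weaker typed statements, two of them lower-dimensional and
certifiable in pieces, and isolates
TransverseCompactness — "two bounded periods suffice" — as the exact 3-D residue of conjunct (i).
Negatives index: empty at filing.

RANKED CRUXES. #0 HcpPeriodicMinimiser (target) — some relaxed hcp stacking hcpPeriodicConfiguration
a h with (a, h) ∈ B = [47/50, 1] × [39a/50, 17a/20] is a least element of the Lennard-Jones energy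
per particle over ALL periodic configurations of ℝ³ (shared verbatim with PoissonBesselStacking item
3061; implies CrysPeriodicMinAttained 0627). (why it might fail: False iff the LJ periodic ground
state is not relaxed hcp: fcc/dhcp win only if J₂ + J₄ + … > 0 (numerics J₂ = −7.25e−5,
Stillinger2001 hcp at p = 0); an exotic large-cell phase below hcp would also break
TransverseCompactness.) [Stillinger2001, BlancLewin2015, LoachAckland2017,
BeterminSamajTravenec2022, PartayOrtnerCsanyi2017]
#2 TransverseCompactness (crux) — (C2, card item Y2, periodic shadow with explicit constants) for
every periodic configuration Q of ℝ³ there is a periodic Q′ with energy per particle ≤ that of Q,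
all distinct points of Q′ at mutual distance ≥ 1/2, and two linearly independent vectors u, v in the
period lattice of Q′ with ‖u‖, ‖v‖ ≤ 6/5 — "two short imposed periods (and a hard core) suffice".
Rotation-invariant as stated; relaxed hcp with (a, h) ∈ B qualifies (folder SanityHcp.lean,
sorry-free), so under the expected picture Q′ = hcp always works; the content is to prove it WITHOUT
identifying the minimiser. Strictly weaker than PoissonBessel's PeriodicReductionToBarlow (uniform
Barlow stackings are in the class). [difficulty: XL] (why it might fail: No known technique bounds
periods short of full layering; FALSE at L = 6/5 if the LJ periodic minimiser were a large-cell
phase (Frank–Kasper A15/σ: every independent period pair > 1.2) or needed in-layer superstructure —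
zero-pressure LJ searches report only close-packed polytypes, uncertified.) [FrankKasper1958,
Stillinger2001, PartayOrtnerCsanyi2017, BeterminSamajTravenec2022, BlancLewin2015, arXiv:1607.08716]
#3 TriangularLayering (crux) — (L2, card item Y3, in the JOINT form the novelty audit demanded)
every periodic Q with hard core 1/2 and two independent periods of length ≤ 6/5 is matched, at no
higher energy per particle, by a periodic MONOLAYER TRIANGULAR STACK Q′: for some a ∈ [47/50, 1] the
period lattice of Q′ contains u_a = (a, 0, 0) and v_a = (a/2, a√3/2, 0), two points of Q′ at the
same height differ by a vector of ℤu_a + ℤv_a (each occupied horizontal plane is ONE translate of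
A₂(a)), distinct occupied heights differ by ≥ 7/10, and above every point there is a point higher by
some t ∈ [7/10, 1] (lateral offsets free, spacings free in [0.7, 1]). At transverse covolume ≤
(6/5)² and hard core 1/2 the competitor's layers carry ≤ 2 orbits per cell at close-packed density,
so this is a family of 2-D lattice-shape problems (Montgomery/Bétermin comparison of Λ against A₂
with LJ-signed interlayer terms) plus certified exclusion of 2-orbit layers, coupled along the
chain. [deps: TransverseCompactness] [difficulty: XL] (why it might fail: Contains 2-D
crystallization for the true (12,6) potential among periodic layers of bounded period (Theil2006's
class excludes (12,6); A₂ is provably optimal only among LATTICES, Montgomery1988 /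
arXiv:2104.09795); 2-orbit layers (buckled honeycomb, ω/AlB₂-type) must lose by certified margins.)
[Theil2006, Montgomery1988, arXiv:2104.09795, arXiv:1607.08716, HeitmannRadin1980, arXiv:2407.20762,
BlancLewin2015]
#4 MonolayerStackOptimality (crux) — (S2′, card items S2/Y4 as ONE typed 1-D chain statement with
continuous letters) every periodic monolayer triangular stack as in TriangularLayering (a ∈ [0.94,
1], arbitrary lateral offsets, consecutive spacings in [0.7, 1]) has energy per particle ≥ that of
some relaxed hcp with (a′, h) ∈ B. Mechanism: adjacent layers lock into deep holes
(AdjacentLayerHoleLocking 3064, to be extended from B to spacings [0.7, 1] and made global in the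
offset), spacings equalise by convexity, the residual offset word is a Hägg word whose registry
couplings are Bessel-signed with |J₂| ≥ 287 Σ_(k≥3)(k−1)|J_k| (LjRegistryDomination 3063), so the
Peierls count HaggDominationAllRanges (0737, O(1) boundary term, arbitrary words) forces ABAB per
period; BarlowEnergyIdentification 3065 and in-plane re-relaxation a ↦ a′ finish. Uses only items
already typed in PoissonBesselStacking as tools. [difficulty: L] (why it might fail: Continuous
letters: off-hole offsets and non-uniform spacings in an aperiodic word could undercut every exact
Barlow stacking by O(J₂²/stiffness) unless locking is proved with margin; false outright if J₂ ≥ 0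
somewhere on B (fcc/dhcp win; numerics J₂ = −7.25e−5, ratio ≥ 287).) [RadinSchulman1983,
LoachAckland2017, BeterminPetrache2017, PartayOrtnerCsanyi2017, Stillinger2001, BlancLewin2015]
#5 CrysPositional (crux) — conjunct (ii) itself, IsCrystallizing lennardJones 3 (shared verbatim
with CrystalLocalRigidity item 0625): IMPORTED, not claimed — it is rung 0 of the ladder and this
route files no mechanism for it (elsewhere it is fed by BulkDefectVanish 0751 +
DefectVanishCrystallizes 0752 + LennardJonesMinimalDistance); listed as a crux because the assembly
to the sub-problem constant needs it and its difficulty must not be hidden. [difficulty: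
open-problem] (why it might fail: It is the positional conjecture: amorphous/polytetrahedral bulk
order or aperiodically stacked LJ ground states refute it, and no 3-D rigidity theorem for PAIR
potentials exists (FlatleyTheil2015 needs a three-body term; Theil2006 is d = 2).) [BlancLewin2015,
FlatleyTheil2015, Theil2006]
#9 HcpEnergyMinOnBox (support) — (shared verbatim with PoissonBesselStacking item 3066)
continuity/compactness: (a, h) ↦ e(hcpPeriodicConfiguration a h) attains its minimum over the
compact box B at some (a₀, h₀) ∈ B (uniform convergence of the LJ lattice sums on B). [difficulty:
provable-now] [BlancLewin2015, BeterminSamajTravenec2022]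
#9 CrysEnergyLimit (support) — (shared verbatim with item 0626, routes CrystalLocalRigidity /
PoissonBesselStacking) E(N)/N → ⨅ over periodic configurations of the LJ energy per particle —
thermodynamic-limit bookkeeping (periodisation 0715 gives ⨅ ≤ E(N)/N; trial blocks 0629 give limsup
≤ ⨅; BlancLewin2015 (8)). [difficulty: M] [BlancLewin2015]
#9 RungTwoGlue (support) — glue of rung 2: TransverseCompactness → TriangularLayering →
MonolayerStackOptimality → HcpEnergyMinOnBox → HcpPeriodicMinimiser. Proof (done in the planner's
Sketch.lean, `rungTwoGlue_provable`): for any periodic Q chain the three matchings e(Q) ≥ e(Q′) ≥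
e(Q″) ≥ e(hcp a′ h) ≥ e(hcp a₀ h₀) and note hcp a₀ h₀ is itself periodic, hence IsLeast.
[difficulty: provable-now] [BlancLewin2015]

TWO-LAYER PLAN. Foreseen glued splits (none filed now; k ≤ 3, depth 1): TransverseCompactness ⇐
HardCoreCleaning (∀ Q ∃ Q′, e ≤, minimal distance
≥ 1/2: orbit deletion / index-2 sublattice surgery + LJ stability) → ShortPeriodPair (hard-core
periodic Q matched by one with two
periods ≤ 6/5: the true residue) → TransverseCompactness. TriangularLayering ⇐ SingleOrbitLayers (at
covolume ≤ (6/5)² with hard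
core, near-optimal layers carry one orbit per transverse cell: certified exclusion of 2-orbit
layers) → LatticeShapeA2 (for
one-orbit layers the optimal Λ is A₂(a), a ∈ [0.94, 1]: Montgomery/Bétermin lattice comparison with
the LJ-signed interlayer
terms) → TriangularLayering. MonolayerStackOptimality ⇐ HoleLockingAllSpacings (3064 extended to t ∈
[0.7, 1], global in the
offset) → UniformSpacing (convexity in t) → MonolayerStackOptimality, the last arrow consuming 3063
+ 0737 + 3065 of
PoissonBesselStacking. SUCCESSOR THESIS (a new route, not a split, once L2/S2′ move): rung 1, R₁ —
minimisers with ONE imposed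
period u (|u| ∈ [0.94, 1]) are periodic: planar crystallization for rods y + ℤu carrying a phase φ ∈
ℝ/ℤ with pair interaction
W(ρ, Δφ) = Σ_n V(√(ρ² + |u|²(Δφ + n)²)) (ρ⁻⁵ tail, 2-D summable; phase differences pinned to {0,
1/2} by the first shell), the
3-D-faithful form of card plane-first-true-lj-12-6, and the first rung that also feeds (ii).

KILL CRITERIA. A periodic configuration certified below every relaxed hcp of the box (e.g. e(fcc) <
e(hcp), i.e. J₂ + J₄ + … > 0, or an exotic
phase) refutes HcpPeriodicMinimiser and MonolayerStackOptimality: if the winner is itself a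
monolayer stack / short-period
structure, restate S2′ and the target with the winner (the ladder survives, hcp does not); otherwise
close
`refuted:MonolayerStackOptimality`. TransverseCompactness refuted by a witness with bounded but
longer periods ⇒ restate with a
larger L (the ladder's content is "some explicit L"); refuted by showing that transverse periods
must diverge along minimising
sequences ⇒ close the route (rung 2 is false, the expected picture fails) and hand the witness to
RefuteCrystalPeriodicMin.
TriangularLayering refuted by a 2-orbit-layer or non-triangular short-period structure beating all
monolayer stacks ⇒ restate
L2's target class if the witness is still layered, close if not. Mooted: HcpPeriodicMinimiser proved
through PoissonBessel's
PeriodicReductionToBarlow makes rung 2 redundant for (i) (rung 1 stays interesting for (ii));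
CrysPositional refuted kills
conjunct (ii) for every route but leaves this route's (i)-content intact.

NOT DECOMPOSED YET. The infinite-volume objects of the card — the classes 𝒞_k of rank-k-invariant
locally finite configurations with a van Hove
energy per particle along the free directions, (F1) equality of the rung infima, (F2) Palais
symmetric criticality (restricted
minimisers are equilibria / Λ-equivariant GSCs of the free energy) — are not needed for the periodic
shadow that implies (i);
they become definition requests when rung 1 is opened. Also deferred: the hard-core cleaning lemma
inside TransverseCompactness;
the value of L beyond 6/5 (a restate knob, not a new idea); in-plane re-relaxation a ↦ a′ and the
extension of hole locking to
spacings [0.7, 0.733) ∪ (0.85, 1] inside MonolayerStackOptimality; rotations (absorbed by the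
existential Q′ and
isometryImage); everything positional (rung 0); the negative side ¬TransverseCompactness (file only
if a large-cell witness appears).

CHEAPEST FALSIFIER. A kit lattice-sum scan (minutes, interval arithmetic optional): relaxed LJ
energies per particle of the short-period non-Barlow
candidates the classes admit — bcc (e = −0.686, 4.4 % above hcp, from A₆ = 12.25, A₁₂ = 9.11),
simple hexagonal AAA with c/a
free, ω/AlB₂-type 2-orbit layers, buckled-honeycomb bilayer stacks — and of the tcp/Frank–Kasper
phases A15 and σ (all period
pairs > 1.2) against relaxed hcp e* = −A₆²/(24A₁₂) = −0.7175 (A₆ = 14.4549, A₁₂ = 12.1323): a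
candidate within 1e−3 of hcp
endangers TriangularLayering's certified margins, one below hcp kills the target, an A15/σ below hcp
refutes TransverseCompactness
at L = 6/5. For S2′ the falsifier is PoissonBessel's: certified J₂ < 0 and Σ_(k≥3)(k−1)|J_k| ≤
|J₂|/2 at the corners of B (their
uncertified scan: J₂ ∈ [−1.5e−4, −3.7e−5], ratio ≥ 287). Not run here (no kit in this seat); what I
did run: SanityHcp.lean
(folder, lean check rc 0, sorry-free) proves hcp(a, h) with (a, h) ∈ B lies in BOTH classes (hard
core min(a, h) ≥ 0.733 ≥ 1/2,
periods |u| = |v| = a ≤ 6/5, one A₂(a)-orbit per height, gaps = h ∈ [0.733, 0.85]) — neither crux is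
vacuous and all three are
implied by "relaxed hcp is the periodic minimiser".

NUMBERS. a* = (A₁₂/A₆)^(1/6) = 0.9712 (hcp A₁₂ = 12.1323, A₆ = 14.4549; fcc 12.1319, 14.4539; bcc
9.114, 12.253); ideal h/a = √(2/3) =
0.8165; box B = [0.94, 1] × [0.78a, 0.85a] (PoissonBesselStacking); tree units min V = V(1) = −1/12,
e*(hcp) = −0.7175 =
−8.610/12, e(fcc) − e(hcp) ≈ +7e−5, e(bcc) = −0.686. Class constants: hard core 1/2 (V(1/2) =
+330.7), period bound 6/5 (admits
the A₂(a) basis |u| = |v| = a ≤ 1 and fcc's square layers; excludes the √3a = 1.68 reconstruction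
and A15/σ cells ≈ 2),
layer gap ≥ 7/10 < 0.733 = 0.78 · 0.94 ≤ h, next layer ≤ 1 ≥ 0.85 ≥ h. Registry numbers
(PoissonBesselStacking): J₁ = +0.78
(holes lock), J₂ = −7.25e−5, J₃ = −8.5e−8, domination ratio ≥ 287 on B. Items at open: 9 (1 target,
4 cruxes incl. the imported
(ii), 3 support, 1 assembly).

DEFINITION REQUESTS. None at open: every item is typed over Crystallization.lean /
BarlowStacking.lean (triangularVec₁, triangularVec₂,
hcpPeriodicConfiguration, PeriodicConfiguration.points/.lattice). When rung 1 is opened: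
`IsRankInvariant k X` (locally finite
X ⊂ ℝ³ invariant under a discrete rank-k subgroup of translations), `slabEnergyPerParticle` /
`rodEnergyPerParticle` (van Hove
limits along the free directions) and the rod pair interaction W(ρ, Δφ), topic
Summits/AtomisticToContinuum/Crystallization/Theorems;
and a cite fact Palais1979 (symmetric criticality for isometric actions) if (F2) is to be used
formally. Bib added this session:
Palais1979, Montgomery1988.

Novelty: Searches (2026-08-15): `lit frontier AtomisticToContinuum --since 2020` (30 rows;
crystallization-relevant arXiv:2407.20762,
arXiv:2604.19239 — planar; nothing on imposed partial periodicity); `lit bridges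
AtomisticToContinuum --cross any` (30 rows,
kinetic/hydrodynamic, none relevant); `lit search --hybrid` ×5 ("minimization among layered periodic
configurations stacking
triangular lattices translated layers", "symmetric criticality Palais invariant minimizer lattice
periodic", "thin film slab
Lennard-Jones layers hcp fcc stacking rigorous", "triangular lattice optimal two-dimensional
lattices theta Montgomery layers fcc
hcp dimension reduction", "Frank-Kasper phases Lennard-Jones ground state hcp A15": hits
arXiv:2107.14020 =
BeterminSamajTravenec2022, Cicalese–Kreutz–Leonardi 2023 Wulff fcc/hcp, textbooks — none with a
rank-of-symmetry reduction);
`lit vsearch` (prose paraphrase of rung 2: books only); `lit galaxy search "layered lattices" --star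
pdf`, `"symmetric criticality"
--star all` (noise); remote OpenAlex/arXiv/S2 legs rate-limited (HTTP 429) and local searchd down
for half the session (logged in
NOTES.md). READ: BeterminPetrache2017 arXiv:1607.08716 pp. 4–5 (Thm 1.1: for a FIXED Λ₀ ⊂ ℝ^(d−1)
and a motif H with the
symmetries of Λ₀, the |H|-periodic bijective stacking words minimise θ_(Λ_s)(α) among periodic
layerings for α ≥ 1/(2πt²), whence
FCC < HCP for completely monotone f; Prop 1.2: θ_(Λ+u) ≤ θ_Λ and A₂ optimal in d = 2 via
Montgomery1988); FriedrichKreutz202  [refs: 2407.20762, 2604.19239, 2107.14020, 1607.08716, 2209.14880, 1504.01153, 2104.09795, BeterminSamajTravenec2022, BeterminPetrache2017, Montgomery1988, FriedrichKreutz2023, BlancLewin2015, Betermin2023, Palais1979, LoachAckland2017]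

Barriers (technique_class: imposed-symmetry-ladder, layer-reduction, hagg-locking): - technique_class: imposed-symmetry-ladder, layer-reduction, hagg-locking
- Literature.Barriers.AtomisticToContinuum.HcpNotBravais: respected by construction — every class in
the route (PeriodicConfiguration with motif; monolayer stacks with arbitrary offset words) contains
hcp (SanityHcp.lean); nothing is minimised over Bravais lattices only.
- Literature.Barriers.AtomisticToContinuum.Hubbard1978_mostHomogeneous: APPLIES to
MonolayerStackOptimality (a 1-D chain with infinite-range couplings AND continuous letters, worse
than Hubbard's setting); evaded only quantitatively — hole locking pins letters to a finite alphabet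
up to O(1e−4) displacements and the Bessel-signed couplings give Hägg domination with margin ≥ 287
(3063 + 0737), i.e. the competing scales are absent for LJ; the barrier's scope (two-body, convex
repulsive, fixed density) does not cover the Hägg functional, and its own lesson (locking off a null
parameter set) is the bet.
- Literature.Barriers.AtomisticToContinuum.NoUniversallyOptimalLattice3D: APPLIES to certifying the
3-D minimiser by a potential-independent bound; evaded by moving the universal-optimality input one
dimension DOWN, where it is a theorem among lattices (Montgomery1988: A₂ minimises every lattice
theta function in d = 2) — TriangularLayering compares 2-D lattices layer by layer with LJ-specific
signs, never a 3-D universal certificate.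
- Literature.Barriers.AtomisticToContinuum.KissingTwelveDegeneracy: contact counting is used
nowhere; Triang

History (route lifecycle, newest last):
- 2026-08-16T03:49:05Z · AUTO-CRUX (backfill): HcpPeriodicMinimiser — hypotheses of the deciding theorem that nothing in the route derives are cruxes (operator:999:586464)
- 2026-08-24T04:06:52Z · DORMANT — reconciler: no traction for 6.5 d (last activity item-evidence-added at 2026-08-17T14:59:29Z); parked, not closed — `ledger route dormant route-AtomisticToConti (operator:999:4071043)
- 2026-08-31T09:30:41Z · REACTIVATED (open) — reconciler: reactivated — activity statement-checked at 2026-08-31T08:34:34Z after parking at 2026-08-24T04:06:52Z (operator:999:2720020)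

sub-problem: Crystallization · status: open · opened planner-plancard-AtomisticToContinuum-Crystal-e9b6a061-0 2026-08-15T11:43:01Z · rev 4 · ledger route-AtomisticToContinuum-SymmetryRankLadder
GENERATED by the gate from the ledger (D-0016/17). Provers cite these decls: `theorem foo : Summit.AtomisticToContinuum.Crystallization.Theses.SymmetryRankLadder.<Decl> := …` in Summits/AtomisticToContinuum/Crystallization/Theorems/<Name>.lean.
-/

namespace Summit.AtomisticToContinuum.Crystallization.Theses.SymmetryRankLadder

open scoped BigOperators Topology Manifold Classical MeasureTheory ProbabilityTheory Matrix InnerProductSpace ComplexConjugate ContinuousMap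
open Filter Set Function TopologicalSpace MeasureTheory

attribute [summit_statement] _root_.Crystallization

/-- item stmt-AtomisticToContinuum-3061 · crux (kind.auto-crux: conjecture-grade) · rank 0 · open · by planner
why it might fail: False iff no hcp(a,h), (a,h) ∈ B, is least among ALL periodic configurations: fcc wins under the soft-exponent sign (SBS2021 p.35: Δ_fcc/hcp = −1.0e−4, fcc for n < 5.7; BST2022 p.8), polytypes where J₂ ≈ 0 (PartayOrtnerCsanyi2017 p.5), or a supercell/non-Barlow phase undercuts the family; floats.
sources: SchwerdtfegerBurrowsSmits2021, BeterminSamajTravenec2022, PartayOrtnerCsanyi2017, Stillinger2001, LoachAckland2017, BlancLewin2015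
[target] X_E: some relaxed HCP stacking with parameters (a,h) in the box B is a least element of the
Lennard-Jones energy per particle over all periodic configurations of ℝ³ (names the minimiser that
0627 leaves anonymous). -/
@[route_item "route-AtomisticToContinuum-SymmetryRankLadder", crux]
def HcpPeriodicMinimiser : Prop :=
  ∃ a h : ℝ, ∃ (ha : a ≠ 0) (hh : h ≠ 0), 47 / 50 ≤ a ∧ a ≤ 1 ∧ 39 / 50 * a ≤ h ∧ h ≤ 17 / 20 * a ∧ IsLeast (Set.range fun Q : Literature.MathematicalPhysics.StatisticalMechanics.PeriodicConfiguration 3 => Q.energyPerParticle Literature.MathematicalPhysics.StatisticalMechanics.lennardJones) ((Literature.MathematicalPhysics.StatisticalMechanics.hcpPeriodicConfiguration ha hh).energyPerParticle Literature.MathematicalPhysics.StatisticalMechanics.lennardJones)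

/-- item stmt-AtomisticToContinuum-5831 · crux · rank 2 · open · by planner
why it might fail: No minimiser-free technique bounds two periods (BeterminPetrache2017 Thm 1.1 presupposes the base lattice); FALSE at L = 6/5 only if a non-layered large-cell phase (σ/A15: period pairs > 1.2) or in-layer superstructure beats hcp — floats: A15 +12 %, bcc +4.5 % (SBS2021 p.35), σ unchecked.
sources: BeterminPetrache2017, arXiv:1607.08716, FrankKasper1958, SchwerdtfegerBurrowsSmits2021, Stillinger2001, PartayOrtnerCsanyi2017
[crux] (C2, card item Y2, periodic shadow with explicit constants) for every periodic configuration
Q of ℝ³ there is a periodic Q′ with energy per particle ≤ that of Q, all distinct points of Q′ at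
mutual distance ≥ 1/2, and two linearly independent vectors u, v in the period lattice of Q′ with
‖u‖, ‖v‖ ≤ 6/5 — "two short imposed periods (and a hard core) suffice". Rotation-invariant as
stated; relaxed hcp with (a, h) ∈ B qualifies (folder SanityHcp.lean, sorry-free), so under the
expected picture Q′ = hcp always works; the content is to prove it WITHOUT identifying the
minimiser. Strictly weaker than PoissonBessel's PeriodicReductionToBarlow (uniform Barlow stackings
are in the class). [difficulty: XL] -/
@[route_item "route-AtomisticToContinuum-SymmetryRankLadder", crux]
def TransverseCompactness : Prop :=
  ∀ Q : Literature.MathematicalPhysics.StatisticalMechanics.PeriodicConfiguration 3, ∃ Q' : Literature.MathematicalPhysics.StatisticalMechanics.PeriodicConfiguration 3, Q'.energyPerParticle Literature.MathematicalPhysics.StatisticalMechanics.lennardJones ≤ Q.energyPerParticle Literature.MathematicalPhysics.StatisticalMechanics.lennardJones ∧ (∀ x ∈ Q'.points, ∀ y ∈ Q'.points, x ≠ y → (1 / 2 : ℝ) ≤ dist x y) ∧ (∃ u ∈ Q'.lattice, ∃ v ∈ Q'.lattice, LinearIndependent ℝ ![u, v] ∧ ‖u‖ ≤ 6 / 5 ∧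 ‖v‖ ≤ 6 / 5)

/-- item stmt-AtomisticToContinuum-5832 · crux · rank 3 · open · by planner
why it might fail: Contains planar (12,6) crystallization, open in d=2: A₂ optimal only among Bravais lattices (Betermin2023 Thm 1.1; Montgomery1988), Theil2006's class excludes (12,6) (not_isAdmissible_lennardJones), planar LJ ground state only numerical (BST2022 p.2); multi-orbit layers must lose by certified margin
sources: Betermin2023, arXiv:2104.09795, Montgomery1988, Theil2006, Literature.Barriers.AtomisticToContinuum.not_isAdmissible_lennardJones, BeterminSamajTravenec2022
[crux] (L2, card item Y3, in the JOINT form the novelty audit demanded) every periodic Q with hard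
core 1/2 and two independent periods of length ≤ 6/5 is matched, at no higher energy per particle,
by a periodic MONOLAYER TRIANGULAR STACK Q′: for some a ∈ [47/50, 1] the period lattice of Q′
contains u_a = (a, 0, 0) and v_a = (a/2, a√3/2, 0), two points of Q′ at the same height differ by a
vector of ℤu_a + ℤv_a (each occupied horizontal plane is ONE translate of A₂(a)), distinct occupied
heights differ by ≥ 7/10, and above every point there is a point higher by some t ∈ [7/10, 1]
(lateral offsets free, spacings free in [0.7, 1]). At transverse covolume ≤ (6/5)² and hard core 1/2
the competitor's layers carry ≤ 2 orbits per cell at close-packed density, so this is a family of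
2-D lattice-shape problems (Montgomery/Bétermin comparison of Λ against A₂ with LJ-signed interlayer
terms) plus certified exclusion of 2-orbit layers, coupled along the chain. [deps:
TransverseCompactness] [difficulty: XL] -/
@[route_item "route-AtomisticToContinuum-SymmetryRankLadder", crux]
def TriangularLayering : Prop :=
  ∀ Q : Literature.MathematicalPhysics.StatisticalMechanics.PeriodicConfiguration 3, (∀ x ∈ Q.points, ∀ y ∈ Q.points, x ≠ y → (1 / 2 : ℝ) ≤ dist x y) → (∃ u ∈ Q.lattice, ∃ v ∈ Q.lattice, LinearIndependent ℝ ![u, v] ∧ ‖u‖ ≤ 6 / 5 ∧ ‖v‖ ≤ 6 / 5) → ∃ Q' : Literature.MathematicalPhysics.StatisticalMechanics.PeriodicConfiguration 3, Q'.energyPerParticle Literature.MathematicalPhysics.StatisticalMechanics.lennardJones ≤ Q.energyPerParticle Literature.MathematicalPhysics.StatisticalMechanics.lennardJones ∧ ∃ a : ℝ, 47 / 50 ≤ a ∧ a ≤ 1 ∧ Literature.MathematicalPhysics.StatisticalMechanics.triangularVec₁ a ∈ Q'.lattice ∧ Literature.MathematicalPhysics.StatisticalMechanics.triangularVec₂ a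 ∈ Q'.lattice ∧ (∀ x ∈ Q'.points, ∀ y ∈ Q'.points, x 2 = y 2 → x - y ∈ Submodule.span ℤ ({Literature.MathematicalPhysics.StatisticalMechanics.triangularVec₁ a, Literature.MathematicalPhysics.StatisticalMechanics.triangularVec₂ a} : Set (EuclideanSpace ℝ (Fin 3)))) ∧ (∀ x ∈ Q'.points, ∀ y ∈ Q'.points, x 2 ≠ y 2 → (7 / 10 : ℝ) ≤ |x 2 - y 2|) ∧ (∀ x ∈ Q'.points, ∃ y ∈ Q'.points, (7 / 10 : ℝ) ≤ y 2 - x 2 ∧ y 2 - x 2 ≤ 1)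

/-- item stmt-AtomisticToContinuum-5833 · crux · rank 4 · open · by planner
why it might fail: Needs hcp certified below fcc, dhcp, all polytypes and off-registry/unequal-spacing stacks: fcc–hcp LJ gap 1.0e−4, floats only, fcc for soft n < 5.7 (SBS2021 p.35; BST2022 p.8); polytypes win where J₂ ≈ 0 (PartayOrtnerCsanyi2017 p.5); hole locking unproved on gaps [0.7,1] (φ̂ sign turns at c/a≈1.1).
sources: SchwerdtfegerBurrowsSmits2021, BeterminSamajTravenec2022, PartayOrtnerCsanyi2017, Stillinger2001, LoachAckland2017, BeterminPetrache2017
[crux] (S2′, card items S2/Y4 as ONE typed 1-D chain statement with continuous letters) every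
periodic monolayer triangular stack as in TriangularLayering (a ∈ [0.94, 1], arbitrary lateral
offsets, consecutive spacings in [0.7, 1]) has energy per particle ≥ that of some relaxed hcp with
(a′, h) ∈ B. Mechanism: adjacent layers lock into deep holes (AdjacentLayerHoleLocking 3064, to be
extended from B to spacings [0.7, 1] and made global in the offset), spacings equalise by convexity,
the residual offset word is a Hägg word whose registry couplings are Bessel-signed with |J₂| ≥ 287
Σ_(k≥3)(k−1)|J_k| (LjRegistryDomination 3063), so the Peierls count HaggDominationAllRanges (0737,
O(1) boundary term, arbitrary words) forces ABAB per period; BarlowEnergyIdentification 3065 and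
in-plane re-relaxation a ↦ a′ finish. Uses only items already typed in PoissonBesselStacking as
tools. [difficulty: L] -/
@[route_item "route-AtomisticToContinuum-SymmetryRankLadder", crux]
def MonolayerStackOptimality : Prop :=
  ∀ Q : Literature.MathematicalPhysics.StatisticalMechanics.PeriodicConfiguration 3, ∀ a : ℝ, 47 / 50 ≤ a → a ≤ 1 → Literature.MathematicalPhysics.StatisticalMechanics.triangularVec₁ a ∈ Q.lattice ∧ Literature.MathematicalPhysics.StatisticalMechanics.triangularVec₂ a ∈ Q.lattice ∧ (∀ x ∈ Q.points, ∀ y ∈ Q.points, x 2 = y 2 → x - y ∈ Submodule.span ℤ ({Literature.MathematicalPhysics.StatisticalMechanics.triangularVec₁ a, Literature.MathematicalPhysics.StatisticalMechanics.triangularVec₂ a} : Set (EuclideanSpace ℝ (Fin 3)))) ∧ (∀ x ∈ Q.points, ∀ y ∈ Q.points, x 2 ≠ y 2 → (7 / 10 : ℝ) ≤ |x 2 - y 2|) ∧ (∀ x ∈ Q.points, ∃ y ∈ Q.points, (7 / 10 : ℝ) ≤ y 2 - x 2 ∧ y 2 - x 2 ≤ 1) → ∃ a' h : ℝ, ∃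 (ha : a' ≠ 0) (hh : h ≠ 0), 47 / 50 ≤ a' ∧ a' ≤ 1 ∧ 39 / 50 * a' ≤ h ∧ h ≤ 17 / 20 * a' ∧ (Literature.MathematicalPhysics.StatisticalMechanics.hcpPeriodicConfiguration ha hh).energyPerParticle Literature.MathematicalPhysics.StatisticalMechanics.lennardJones ≤ Q.energyPerParticle Literature.MathematicalPhysics.StatisticalMechanics.lennardJones

/-- item stmt-AtomisticToContinuum-0625 · crux · rank 5 · open · by planner
why it might fail: Conjunct (ii) itself, 'completely open in dimension three' (BlancLewin2015 p.7): the one 3-D theorem needs a three-body term (FlatleyTheil2015 Thm 1.1), Theil2006 is planar and excludes (12,6) (not_isAdmissible_lennardJones); false under bulk aperiodic order or degenerate faulted stacking; imported.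
sources: BlancLewin2015, arXiv:1504.01153, FlatleyTheil2015, arXiv:1407.0692, Theil2006, Literature.Barriers.AtomisticToContinuum.not_isAdmissible_lennardJones
Blanc–Lewin positional crystallization for Lennard-Jones in ℝ³ (conjunct (ii) itself): the route's
content is (a) local optimality + (b) rigidity for a PAIR potential in 3-D without Flatley–Theil's
auxiliary three-body term (arXiv:1407.0692 Thm 1.1, p.4) + (c) periodic optimal stacking ⇒ every
vague limit of translated ground states along a subsequence is a non-zero window of a periodic
optimal stacking. -/
@[route_item "route-AtomisticToContinuum-SymmetryRankLadder", crux]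
def CrysPositional : Prop :=
  Literature.MathematicalPhysics.StatisticalMechanics.IsCrystallizing Literature.MathematicalPhysics.StatisticalMechanics.lennardJones 3

/-- item stmt-AtomisticToContinuum-0626 · support · rank 9 · closed · proved by Summit.AtomisticToContinuum.Crystallization.Theorems.crysEnergyLimit_proof @ f456c3bab3f9 (prover) · by planner
sources: BlancLewin2015
Energetic crystallization: E(N)/N converges to the infimum over periodic (multi-lattice)
configurations of the LJ energy per particle in d = 3. Lower bound liminf ≥ ⨅ is the content ((a)
local optimality + (d) + surface term O(N^{2/3})); upper bound is filed separately. -/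
@[route_item "route-AtomisticToContinuum-SymmetryRankLadder", crux]
def CrysEnergyLimit : Prop :=
  Filter.Tendsto (fun N : ℕ => Literature.MathematicalPhysics.StatisticalMechanics.groundStateEnergy Literature.MathematicalPhysics.StatisticalMechanics.lennardJones 3 N / N) Filter.atTop (nhds (⨅ Q : Literature.MathematicalPhysics.StatisticalMechanics.PeriodicConfiguration 3, Q.energyPerParticle Literature.MathematicalPhysics.StatisticalMechanics.lennardJones))

/-- `CrysEnergyLimit` holds: proved by `Summit.AtomisticToContinuum.Crystallization.Theorems.crysEnergyLimit_proof` @ f456c3bab3f9. -/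
theorem CrysEnergyLimit_holds : CrysEnergyLimit := _root_.Summit.AtomisticToContinuum.Crystallization.Theorems.crysEnergyLimit_proof

/-- item stmt-AtomisticToContinuum-3066 · support · rank 9 · open · by planner
sources: BlancLewin2015, BeterminSamajTravenec2022
[support] continuity/compactness: (a,h) ↦ energyPerParticle lennardJones (hcpPeriodicConfiguration a
h) attains its minimum over the compact box B at some (a₀,h₀) ∈ B (uniform convergence of the LJ
lattice sums on B). [difficulty: provable-now] -/
@[route_item "route-AtomisticToContinuum-SymmetryRankLadder", crux]
def HcpEnergyMinOnBox : Prop :=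
  ∃ a₀ h₀ : ℝ, ∃ (ha₀ : a₀ ≠ 0) (hh₀ : h₀ ≠ 0), 47 / 50 ≤ a₀ ∧ a₀ ≤ 1 ∧ 39 / 50 * a₀ ≤ h₀ ∧ h₀ ≤ 17 / 20 * a₀ ∧ ∀ a h : ℝ, ∀ (ha : a ≠ 0) (hh : h ≠ 0), 47 / 50 ≤ a → a ≤ 1 → 39 / 50 * a ≤ h → h ≤ 17 / 20 * a → (Literature.MathematicalPhysics.StatisticalMechanics.hcpPeriodicConfiguration ha₀ hh₀).energyPerParticle Literature.MathematicalPhysics.StatisticalMechanics.lennardJones ≤ (Literature.MathematicalPhysics.StatisticalMechanics.hcpPeriodicConfiguration ha hh).energyPerParticle Literature.MathematicalPhysics.StatisticalMechanics.lennardJones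

/-- item stmt-AtomisticToContinuum-5834 · support · rank 9 · open · by planner
sources: BlancLewin2015
[support] glue of rung 2: TransverseCompactness → TriangularLayering → MonolayerStackOptimality →
HcpEnergyMinOnBox → HcpPeriodicMinimiser. Proof (done in the planner's Sketch.lean,
`rungTwoGlue_provable`): for any periodic Q chain the three matchings e(Q) ≥ e(Q′) ≥ e(Q″) ≥ e(hcp
a′ h) ≥ e(hcp a₀ h₀) and note hcp a₀ h₀ is itself periodic, hence IsLeast. [difficulty:
provable-now] -/
@[route_item "route-AtomisticToContinuum-SymmetryRankLadder", crux]
def RungTwoGlue : Prop :=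
  TransverseCompactness → TriangularLayering → MonolayerStackOptimality → HcpEnergyMinOnBox → HcpPeriodicMinimiser

/-- item stmt-AtomisticToContinuum-5835 · assembly · rank 1 · open · by planner
sources: BlancLewin2015
[assembly] HcpPeriodicMinimiser → CrysEnergyLimit → CrysPositional → Crystallization. -/
@[route_item "route-AtomisticToContinuum-SymmetryRankLadder", crux]
def Assembly : Prop :=
  HcpPeriodicMinimiser → CrysEnergyLimit → CrysPositional → Crystallization

/-! D-0027 §2.1 — DECIDING THEOREM (planner-authored via `route open/edit --closes-file`; by planner-rrepair-AtomisticToContinuum-SymmetryR-3ddfd5bf-g2-0 2026-08-15T16:29:56Z):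
its hypotheses are this route's items and its conclusion the sub-problem Statement (glue_lint), and it elaborates with this file. -/

@[closes "route-AtomisticToContinuum-SymmetryRankLadder"] theorem closes : HcpPeriodicMinimiser → TransverseCompactness → TriangularLayering → MonolayerStackOptimality → CrysPositional → CrysEnergyLimit → HcpEnergyMinOnBox → RungTwoGlue → Assembly → _root_.Crystallization := fun hMin _hC2 _hL2 _hS2 hPos hLim _hBox _hGlue hAsm => hAsm hMin hLim hPos

end Summit.AtomisticToContinuum.Crystallization.Theses.SymmetryRankLadder
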